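import Summits.QuantumFields.BalabanUV.Beta.EriceRemainderEnclosureHistoryAutonomyComparisonAgeCompositionOldBlockCap
import Summits.QuantumFields.BalabanUV.Beta.EriceRemainderEnclosureHistoryAutonomyComparisonAgeCompositionNearPairSeparatedAges

/-!
# EriceRemainderEnclosureHistoryAutonomyComparisonAgeCompositionOldBlockSeparatedAges — (E100c) route (N), first order: DENSE OLD OCTAVES AS CASCADE
# LEVELS.  Gen 87 made NEAR OLD PAIRS `{a_j, p_j}` (`p_j ≤ 2a_j`) levels of every ×61 chain theorem ((E99d) `flow_nonneg_near_pair_levels_of_cap`, cap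
# `0.617`).  With the old-block cap (E100b) `old_block_load_le` (`Σ_{k∈T} x_k ≤ 5∕8` for ANY finite `T ⊂ [a, p]`, `56 ≤ a`, `p ≤ 2a`) every older
# level may now be an ARBITRARY FINITE SET OF AGES INSIDE ONE OCTAVE `T_j ⊂ [a_j, p_j]`, `p_j ≤ 2a_j` — a single age, a near pair, a dense block of
# any size —, the chain condition reading `R₀·p_j ≤ a_{j+1}`:
# **`flow_nonneg_old_block_levels_of_cap`** (parametric: the block cap `(s, Fm)` itself a hypothesis — span 2 at `5∕8` here, span 4 at `11∕16` in
# (E100e)∕(E100f) —, ANY youngest cluster `S₀` with a typed cap `s₀`, `56 ≤ R₀·hi₀`, closure `κ + 4s(1+κ) ≤ R₀(1 − s(1+κ))κ`, `s₀(1+κ) ≤ 1`),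
# **`flow_nonneg_census_young_pair_old_blocks`** (`S₀ = {1, k₂}`, `2 ≤ k₂ ≤ 29`, cap `0.8333`,
# `κ = 1∕5`, ×64: `3.2 ≤ 3.2`), **`flow_nonneg_young_age_old_blocks`** (`S₀ = {a₀}`, ANY `a₀ ≥ 1`, cap `0.7072`, `κ = 1∕4`, ×62: `3.375 ≤ 3.390625`).
# The price of a dense octave against a near pair is the cap `5∕8` against `0.617`: ×64 ∕ ×62 against ×61 ∕ ×59.

Cell `pub-balaban`, β-function sub-cell, BINDER row D4 «RemainderConst leaves for Bałaban's split» (`HOME/BINDER-OWNERS.md`; owner lineage `b2b-balaban-beta-an4`;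
this file by co-owner #2 lineage `b2b-balaban-beta-d4-p2`, generation 88), β-FLOW TEAM duty (1), FREEZE (0) honoured (def-free; nothing restated).

HONEST FRAMING (page 1, verbatim and binding).  *"Discharging BetaPertH makes Bałaban's UV stability UNCONDITIONAL — a real constructive-QFT result; it is
NOT the continuum limit and NOT the Clay problem."*  THIS FILE DISCHARGES NOTHING OF THE KIND.  Elementary real algebra ∕ real analysis about ABSTRACT
functionals on a box ]0,γ]^ℕ with displayed floors, profiles and signs, and the FIRST-ORDER renewal objects of route (N) built from them — hypotheses of a
census, not facts; the form, signs, ages and moments of Bałaban's (1.22) limit functional are NOT PRINTED ([I] p. 298; GAPS G-t4-U2-1∕-2) and NOT asserted.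
Row D4 class UNCHANGED (critical-path width 0; instance 0∕1; D4 DISCHARGE NO DATE).  HONEST DEPENDENCY: continuum YM on T⁴ ⇐ BetaPertH ∧ nine spine
estimates (0/9 proved); BetaPertH ⇐ (D1) ∧ (D4) ∧ CAP+tail; G-an2-4 gates asym, D1 and NE2/3/4.

THE POINT (README `HOME/b2b-balaban-beta-d4-p2/g88/README.md` §3).  A dense old octave exports what a single old age exports: window `hi = p`, youngest
`lo = a`, mass `≤ 5∕8` (one age: `0.6142`), rate `Σ 4c_k` with `lo·ν ≤ 4x`; the engine (E99c) `flow_nonneg_cluster_levels_of_caps` takes it verbatim.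
Uses (E99c) `flow_nonneg_cluster_levels_of_caps`, (E100b) `old_block_load_le`, (E97c) `young_pair_load_le`, (E94b) `load_le_of_sq` BY NAME.  NOT CLAIMED:
octaves wider than `p_j ≤ 2a_j`; consecutive blocks closer than ×62; anything printed — NOT B12 Thm 2, NOT BetaPertH, NOT continuum, NOT Clay.

WHAT IS PROVED ([folklore]; 0 `def`, 0 sorry).  §1 **`flow_nonneg_old_block_levels_of_cap`**.  §2 **`flow_nonneg_census_young_pair_old_blocks`**,
**`flow_nonneg_young_age_old_blocks`**.
-/
noncomputable section
open Finset

namespace Summit.QuantumFields.BalabanUV.Beta.EriceRemainderEnclosureHistoryAutonomyComparisonAgeCompositionOldBlockSeparatedAges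

open Literature.MathematicalPhysics.QuantumFieldTheory.Balaban1983to89
open Literature.MathematicalPhysics.QuantumFieldTheory.Balaban1983to89.T4BetaStationary
open Literature.MathematicalPhysics.QuantumFieldTheory.Balaban1983to89.T4BetaFlowWellPosed
open Summit.QuantumFields.BalabanUV.Beta.EriceRemainderEnclosureHistoryAutonomyComparisonAgeCompositionYoungPairMoment (load_le_of_sq)
open Summit.QuantumFields.BalabanUV.Beta.EriceRemainderEnclosureHistoryAutonomyComparisonAgeCompositionOldBlockCap (old_block_load_le)
open Summit.QuantumFields.BalabanUV.Beta.EriceRemainderEnclosureHistoryAutonomyComparisonAgeCompositionClusterLevels (flow_nonneg_cluster_levels_of_caps)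
open Summit.QuantumFields.BalabanUV.Beta.EriceRemainderEnclosureHistoryAutonomyComparisonAgeCompositionYoungPairCapSeparatedAges (young_pair_load_le)

variable {B : (ℕ → ℝ) → ℝ} {γ b gIR : ℝ} {L : ℕ → ℝ} {K : ℕ} {h g : ℕ → ℝ}

/-! ## §1 Old blocks above any capped youngest cluster (parametric) -/

/-- **OLD BLOCKS AS CASCADE LEVELS ABOVE ANY CAPPED YOUNGEST CLUSTER.**  `B` an isotone memory with floor `b > 0` dominating the profile `L ≥ 0` (`K ≥ 1`
ages), `h` a box solution, `g` a damping of the self-consistent class, the route-(N) renewal objects `KL`, `KA`, `RA`, excess `e ≥ 0` non-increasing,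
zero-tailed `ε = e − RA 1 ε`.  A BLOCK CAP of span `Fm` and value `s ≥ 0`: every finite set of ages inside `[lo, hi]`, `56 ≤ lo`, `hi ≤ Fm·lo`, `hi < K`,
carries `Σ x_k(q) ≤ s` (span 2: `s = 5∕8`, (E100b) `old_block_load_le`; span 4: `s = 11∕16`, (E100e)).  LEVELS: a youngest cluster `S₀ ⊂ [1, K)` with
window `hi₀` (`k ≤ hi₀` on `S₀`, `56 ≤ R₀·hi₀`) and a typed cap `Σ_{k∈S₀} x_k(q) ≤ s₀`; older levels `1 ≤ j < r` ARBITRARY finite sets `T j` of ages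
inside `[a j, p j]`, `a j ≤ p j ≤ Fm·a j`, `p j < K`; SEPARATION `R₀·hi₀ ≤ a 1`, `R₀·p j ≤ a (j+1)`; the profile vanishes off `S₀ ∪ ⋃_j T j`.  CLOSURE
`κ > 0`, `s₀(1+κ) ≤ 1`, `s(1+κ) < 1`, `κ + 4s(1+κ) ≤ R₀(1 − s(1+κ))κ`, `R₀ ≥ 2`.  THEN `0 ≤ ε ≤ e` at every pin ((E99c) `flow_nonneg_cluster_levels_of_caps` with
`S j = T j`, `lo j = a j`, `hi j = p j` — `a j ≥ R₀·hi₀ ≥ 56`). [folklore] -/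
theorem flow_nonneg_old_block_levels_of_cap
    (hmono : ∀ u v : ℕ → ℝ, SeqBox γ u → SeqBox γ v → (∀ j, u j ≤ v j) → B u ≤ B v)
    (hL : ∀ k, 0 ≤ L k) (hb : 0 < b) (hlo : ∀ u, SeqBox γ u → b ≤ B u) (hdom : ∀ u, SeqBox γ u → ∑ k ∈ range K, L k * u k ≤ B u)
    (hh : SeqBox γ h) (hf : MemFlow B gIR h) (hg : ∀ t, 0 < g t ∧ g t ≤ 1)
    (hgF : ∀ t, 1 ≤ g t * (1 + ∑ k ∈ range K, L k * h (t + k) ^ 3 / 2)) (hK : 1 ≤ K)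
    {κ s₀ s : ℝ} {R₀ Fm : ℕ} (hκ : 0 < κ) (hs : 0 ≤ s) (hs₀C : s₀ * (1 + κ) ≤ 1) (hsC : s * (1 + κ) < 1)
    (hR : κ + 4 * s * (1 + κ) ≤ (R₀ : ℝ) * (1 - s * (1 + κ)) * κ) (hR2 : 2 ≤ R₀)
    (hblock : ∀ (S : Finset ℕ) (lo hi q : ℕ), 56 ≤ lo → hi ≤ Fm * lo → hi < K → (∀ k ∈ S, lo ≤ k ∧ k ≤ hi) →
      ∑ k ∈ S, (k : ℝ) * (L k * h (q + k) ^ 3 / 2) ≤ s)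
    {S₀ : Finset ℕ} {hi₀ : ℕ} (hS₀K : ∀ k ∈ S₀, 1 ≤ k ∧ k < K) (hS₀hi : ∀ k ∈ S₀, k ≤ hi₀) (hR56 : 56 ≤ R₀ * hi₀)
    (hcap0 : ∀ q, ∑ k ∈ S₀, (k : ℝ) * (L k * h (q + k) ^ 3 / 2) ≤ s₀)
    {r : ℕ} {T : ℕ → Finset ℕ} {a p : ℕ → ℕ} (hr : 1 ≤ r) (hap : ∀ j, 1 ≤ j → j < r → a j ≤ p j ∧ p j ≤ Fm * a j)
    (hpK : ∀ j, 1 ≤ j → j < r → p j < K) (hT : ∀ j, 1 ≤ j → j < r → ∀ k ∈ T j, a j ≤ k ∧ k ≤ p j)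
    (hsep0 : 1 < r → R₀ * hi₀ ≤ a 1) (hsep : ∀ j, 1 ≤ j → j + 1 < r → R₀ * p j ≤ a (j + 1))
    (hLa : ∀ l, l < K → l ∉ S₀ → (∀ j, 1 ≤ j → j < r → l ∉ T j) → L l = 0)
    {N : ℕ} {KL : ℕ → ℕ → ℕ → ℝ}
    (hKL : ∀ k n l, KL k n l = if 0 < k ∧ k < K ∧ l < k then L k * h (n + k) ^ 3 / 2 * ∏ t ∈ Ico (n + 1 + l) (n + k + 1), g t else 0)
    {KA : ℕ → ℕ → ℕ → ℝ} {RA : ℕ → (ℕ → ℝ) → ℕ → ℝ}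
    (hRA : ∀ i v m, RA i v m = ∑ l ∈ range K, KA i m l * v (m + 1 + l))
    (hKA : ∀ i m l, KA i m l = KL i m l + KA (i + 1) m l) (hKAtop : ∀ m l, KA K m l = 0)
    {e ε : ℕ → ℝ} (he0 : ∀ m, 0 ≤ e m) (hea : ∀ m, e (m + 1) ≤ e m)
    (hεt : ∀ m, N < m → ε m = 0) (hεrec : ∀ m, ε m = e m - RA 1 ε m) : ∀ m, 0 ≤ ε m ∧ ε m ≤ e m := by
  -- the window of each level and the chain of separations
  obtain ⟨HI, hHI⟩ : ∃ HI : ℕ → ℕ, ∀ j, HI j = if j = 0 then hi₀ else p j := ⟨_, fun _ => rfl⟩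
  have hHI0 : HI 0 = hi₀ := by rw [hHI]; simp
  have hHIS : ∀ j, 1 ≤ j → HI j = p j := fun j hj => by rw [hHI, if_neg (by omega)]
  have hchain : ∀ i j, i < j → j < r → R₀ * HI i ≤ a j := by
    intro i j hij hjr
    induction j, hij using Nat.le_induction with
    | base =>
      rcases Nat.eq_zero_or_pos i with rfl | hi
      · rw [hHI0]; exact hsep0 (by omega)
      · rw [hHIS i hi]; exact hsep i hi (by omega)
    | succ j hle ih =>
      have h1 := ih (by omega)
      have h2 := hsep j (by omega) hjr
      have h3 := (hap j (by omega) (by omega)).1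
      have h4 : p j ≤ R₀ * p j := Nat.le_mul_of_pos_left _ (by omega)
      omega
  have ha56 : ∀ j, 1 ≤ j → j < r → 56 ≤ a j := by
    intro j hj hjr
    have := hchain 0 j (by omega) hjr
    rw [hHI0] at this; omega
  refine flow_nonneg_cluster_levels_of_caps hmono hL hb hlo hdom hh hf hg hgF hK hκ hs hs₀C hsC hR
    (r := r) (S := fun j => if j = 0 then S₀ else T j) (lo := fun j => if j = 0 then 1 else a j) (hi := HI)
    (fun j hj k hk => ?_) (fun j hj k hk => ?_) (fun j hj k hk => ?_) (fun j hj1 hjr => ?_) (fun j hj => ?_) (fun i j hij hjr => ?_)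
    (fun l hl hno => ?_) (fun q => ?_) (fun j q hj1 hjr => ?_) hKL hRA hKA hKAtop he0 hea hεt hεrec
  · -- members are ages in [1, K)
    by_cases hj0 : j = 0
    · subst hj0; simp only [if_true] at hk; exact hS₀K k hk
    · simp only [if_neg hj0] at hk
      have h1 := ha56 j (by omega) hj; have h2 := hT j (by omega) hj k hk; have h3 := hpK j (by omega) hj
      omega
  · -- members are ≥ lo
    by_cases hj0 : j = 0
    · subst hj0; simp only [if_true] at hk ⊢; exact (hS₀K k hk).1
    · simp only [if_neg hj0] at hk ⊢; exact (hT j (by omega) hj k hk).1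
  · -- members are ≤ hi
    by_cases hj0 : j = 0
    · subst hj0; simp only [if_true] at hk; rw [hHI0]; exact hS₀hi k hk
    · simp only [if_neg hj0] at hk
      rw [hHIS j (by omega)]; exact (hT j (by omega) hj k hk).2
  · -- lo ≤ hi for the older levels
    simp only [if_neg (show j ≠ 0 by omega)]
    rw [hHIS j hj1]; exact (hap j hj1 hjr).1
  · -- separation R₀·hi j ≤ lo (j+1) = a (j+1)
    simp only [if_neg (Nat.succ_ne_zero j)]
    exact hchain j (j + 1) (by omega) hj
  · -- the clusters are pairwise disjoint: everything in level i lies below everything in level j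
    have hlt : ∀ x, x ∈ (if i = 0 then S₀ else T i) → ∀ y, y ∈ (if j = 0 then S₀ else T j) → x < y := by
      intro x hx y hy
      have hj0 : j ≠ 0 := by omega
      simp only [if_neg hj0] at hy
      have hc := hchain i j hij hjr
      have hay : a j ≤ y := (hT j (by omega) hjr y hy).1
      have hxH : 1 ≤ x ∧ x ≤ HI i := by
        by_cases hi0 : i = 0
        · subst hi0; simp only [if_true] at hx; rw [hHI0]; exact ⟨(hS₀K x hx).1, hS₀hi x hx⟩
        · simp only [if_neg hi0] at hx
          rw [hHIS i (by omega)]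
          have h1 := ha56 i (by omega) (by omega); have h2 := hT i (by omega) (by omega) x hx
          omega
      have h6 : 2 * HI i ≤ R₀ * HI i := Nat.mul_le_mul_right _ hR2
      omega
    exact disjoint_left.mpr fun x hx hx' => lt_irrefl x (hlt x hx x hx')
  · -- the profile vanishes off the clusters
    refine hLa l hl (by simpa using hno 0 (by omega)) fun j hj1 hjr => ?_
    have := hno j hjr
    simp only [if_neg (show j ≠ 0 by omega)] at this
    exact this
  · -- the youngest cap
    simp only [if_true]; exact hcap0 q
  · -- the older caps: the block cap of the span
    simp only [if_neg (show j ≠ 0 by omega)]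
    have h2 := hap j hj1 hjr
    exact hblock (T j) (a j) (p j) q (ha56 j hj1 hjr) h2.2 (hpK j hj1 hjr) (hT j hj1 hjr)

/-! ## §2 The census young pair, or any young age, below a chain of old blocks -/

/-- **THE CENSUS YOUNG PAIR `{1, k₂}`, `2 ≤ k₂ ≤ 29`, BELOW A ×64 CHAIN OF OLD BLOCKS, ANY NUMBER OF LEVELS.**  Profile carried by
`{1, k₂} ∪ ⋃_{1≤j<r} T j` with `T j ⊂ [a j, p j]` finite and arbitrary, `a j ≤ p j ≤ 2·a j`, `64k₂ ≤ a 1`, `64·p j ≤ a (j+1)`: `0 ≤ ε ≤ e` at every pin,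
every horizon, every damping of the self-consistent class (`κ = 1∕5`, caps `0.8333` (E97c) and `5∕8` (E100b), `R₀ = 64`: `3.2 ≤ 3.2`). [folklore] -/
theorem flow_nonneg_census_young_pair_old_blocks
    (hmono : ∀ u v : ℕ → ℝ, SeqBox γ u → SeqBox γ v → (∀ j, u j ≤ v j) → B u ≤ B v)
    (hL : ∀ k, 0 ≤ L k) (hb : 0 < b) (hlo : ∀ u, SeqBox γ u → b ≤ B u) (hdom : ∀ u, SeqBox γ u → ∑ k ∈ range K, L k * u k ≤ B u)
    (hh : SeqBox γ h) (hf : MemFlow B gIR h) (hg : ∀ t, 0 < g t ∧ g t ≤ 1)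
    (hgF : ∀ t, 1 ≤ g t * (1 + ∑ k ∈ range K, L k * h (t + k) ^ 3 / 2))
    {k₂ : ℕ} (hk2 : 2 ≤ k₂) (hk29 : k₂ ≤ 29) (hk2K : k₂ < K)
    {r : ℕ} {T : ℕ → Finset ℕ} {a p : ℕ → ℕ} (hr : 1 ≤ r) (hap : ∀ j, 1 ≤ j → j < r → a j ≤ p j ∧ p j ≤ 2 * a j)
    (hpK : ∀ j, 1 ≤ j → j < r → p j < K) (hT : ∀ j, 1 ≤ j → j < r → ∀ k ∈ T j, a j ≤ k ∧ k ≤ p j)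
    (hsep0 : 1 < r → 64 * k₂ ≤ a 1) (hsep : ∀ j, 1 ≤ j → j + 1 < r → 64 * p j ≤ a (j + 1))
    (hLa : ∀ l, l < K → l ≠ 1 → l ≠ k₂ → (∀ j, 1 ≤ j → j < r → l ∉ T j) → L l = 0)
    {N : ℕ} {KL : ℕ → ℕ → ℕ → ℝ}
    (hKL : ∀ k n l, KL k n l = if 0 < k ∧ k < K ∧ l < k then L k * h (n + k) ^ 3 / 2 * ∏ t ∈ Ico (n + 1 + l) (n + k + 1), g t else 0)
    {KA : ℕ → ℕ → ℕ → ℝ} {RA : ℕ → (ℕ → ℝ) → ℕ → ℝ}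
    (hRA : ∀ i v m, RA i v m = ∑ l ∈ range K, KA i m l * v (m + 1 + l))
    (hKA : ∀ i m l, KA i m l = KL i m l + KA (i + 1) m l) (hKAtop : ∀ m l, KA K m l = 0)
    {e ε : ℕ → ℝ} (he0 : ∀ m, 0 ≤ e m) (hea : ∀ m, e (m + 1) ≤ e m)
    (hεt : ∀ m, N < m → ε m = 0) (hεrec : ∀ m, ε m = e m - RA 1 ε m) : ∀ m, 0 ≤ ε m ∧ ε m ≤ e m := by
  refine flow_nonneg_old_block_levels_of_cap hmono hL hb hlo hdom hh hf hg hgF (by omega) (κ := 1 / 5) (s₀ := 8333 / 10000) (s := 5 / 8)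
    (R₀ := 64) (Fm := 2) (by norm_num) (by norm_num) (by norm_num) (by norm_num) (by norm_num) (by norm_num)
    (fun S lo hi q h1 h2 h3 h4 => old_block_load_le hmono hL hb hlo hdom hh hf h1 h2 h3 h4 q) (S₀ := {1, k₂}) (hi₀ := k₂)
    (fun k hk => ?_) (fun k hk => ?_) (by omega) (fun q => ?_) hr hap hpK hT hsep0 hsep (fun l hl hl0 hno => ?_) hKL hRA hKA hKAtop he0 hea hεt hεrec
  · simp only [mem_insert, mem_singleton] at hk; rcases hk with rfl | rfl <;> omega
  · simp only [mem_insert, mem_singleton] at hk; rcases hk with rfl | rfl <;> omega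
  · rw [sum_pair (show (1 : ℕ) ≠ k₂ by omega), Nat.cast_one, one_mul]
    exact young_pair_load_le hmono hL hb hlo hdom hh hf hk2 hk29 hk2K q
  · refine hLa l hl (fun h1 => hl0 ?_) (fun h2 => hl0 ?_) hno
    · rw [h1]; exact mem_insert_self _ _
    · rw [h2]; exact mem_insert_of_mem (mem_singleton_self _)

/-- **ANY YOUNG AGE BELOW A ×62 CHAIN OF OLD BLOCKS, ANY NUMBER OF LEVELS.**  Profile carried by `{a₀} ∪ ⋃_{1≤j<r} T j` with `a₀ ≥ 1` ARBITRARY,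
`T j ⊂ [a j, p j]` finite and arbitrary, `a j ≤ p j ≤ 2·a j`, `62a₀ ≤ a 1`, `62·p j ≤ a (j+1)`: `0 ≤ ε ≤ e` at every pin (`κ = 1∕4`, caps `0.7072` ((E94b)
`load_le_of_sq`, any age) and `5∕8`, `R₀ = 62`: `3.375 ≤ 3.390625`). [folklore] -/
theorem flow_nonneg_young_age_old_blocks
    (hmono : ∀ u v : ℕ → ℝ, SeqBox γ u → SeqBox γ v → (∀ j, u j ≤ v j) → B u ≤ B v)
    (hL : ∀ k, 0 ≤ L k) (hb : 0 < b) (hlo : ∀ u, SeqBox γ u → b ≤ B u) (hdom : ∀ u, SeqBox γ u → ∑ k ∈ range K, L k * u k ≤ B u)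
    (hh : SeqBox γ h) (hf : MemFlow B gIR h) (hg : ∀ t, 0 < g t ∧ g t ≤ 1)
    (hgF : ∀ t, 1 ≤ g t * (1 + ∑ k ∈ range K, L k * h (t + k) ^ 3 / 2))
    {a₀ : ℕ} (ha0 : 1 ≤ a₀) (ha0K : a₀ < K)
    {r : ℕ} {T : ℕ → Finset ℕ} {a p : ℕ → ℕ} (hr : 1 ≤ r) (hap : ∀ j, 1 ≤ j → j < r → a j ≤ p j ∧ p j ≤ 2 * a j)
    (hpK : ∀ j, 1 ≤ j → j < r → p j < K) (hT : ∀ j, 1 ≤ j → j < r → ∀ k ∈ T j, a j ≤ k ∧ k ≤ p j)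
    (hsep0 : 1 < r → 62 * a₀ ≤ a 1) (hsep : ∀ j, 1 ≤ j → j + 1 < r → 62 * p j ≤ a (j + 1))
    (hLa : ∀ l, l < K → l ≠ a₀ → (∀ j, 1 ≤ j → j < r → l ∉ T j) → L l = 0)
    {N : ℕ} {KL : ℕ → ℕ → ℕ → ℝ}
    (hKL : ∀ k n l, KL k n l = if 0 < k ∧ k < K ∧ l < k then L k * h (n + k) ^ 3 / 2 * ∏ t ∈ Ico (n + 1 + l) (n + k + 1), g t else 0)
    {KA : ℕ → ℕ → ℕ → ℝ} {RA : ℕ → (ℕ → ℝ) → ℕ → ℝ}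
    (hRA : ∀ i v m, RA i v m = ∑ l ∈ range K, KA i m l * v (m + 1 + l))
    (hKA : ∀ i m l, KA i m l = KL i m l + KA (i + 1) m l) (hKAtop : ∀ m l, KA K m l = 0)
    {e ε : ℕ → ℝ} (he0 : ∀ m, 0 ≤ e m) (hea : ∀ m, e (m + 1) ≤ e m)
    (hεt : ∀ m, N < m → ε m = 0) (hεrec : ∀ m, ε m = e m - RA 1 ε m) : ∀ m, 0 ≤ ε m ∧ ε m ≤ e m := by
  refine flow_nonneg_old_block_levels_of_cap hmono hL hb hlo hdom hh hf hg hgF (by omega) (κ := 1 / 4) (s₀ := 7072 / 10000) (s := 5 / 8)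
    (R₀ := 62) (Fm := 2) (by norm_num) (by norm_num) (by norm_num) (by norm_num) (by norm_num) (by norm_num)
    (fun S lo hi q h1 h2 h3 h4 => old_block_load_le hmono hL hb hlo hdom hh hf h1 h2 h3 h4 q) (S₀ := {a₀}) (hi₀ := a₀)
    (fun k hk => ?_) (fun k hk => ?_) (by omega) (fun q => ?_) hr hap hpK hT hsep0 hsep (fun l hl hl0 hno => ?_) hKL hRA hKA hKAtop he0 hea hεt hεrec
  · rw [mem_singleton] at hk; subst hk; exact ⟨ha0, ha0K⟩
  · rw [mem_singleton] at hk; omega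
  · rw [sum_singleton]
    have ha0r : (1 : ℝ) ≤ a₀ := by exact_mod_cast ha0
    exact load_le_of_sq hmono hL hb hlo hdom hh hf ha0 ha0K (so := 7072 / 10000) (by norm_num) (by nlinarith) q
  · exact hLa l hl (fun h1 => hl0 (by rw [h1]; exact mem_singleton_self _)) hno

end Summit.QuantumFields.BalabanUV.Beta.EriceRemainderEnclosureHistoryAutonomyComparisonAgeCompositionOldBlockSeparatedAges
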